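/-
Copyright (c) 2026 the pub-hodgecm-mathlib formalisation cell (harness21).  Prover seat hodgecm-mathlib-A-p19 (g27), 2026-09-02.  Road «S3-tree»∕«S3-ram» (LEAD F0P3a-plan (g12)
T11-41∕T11-52; owner p06 (g15)), row (e2) «P-2-ram», organ «THE LAW AT THE PLACE: SELF-DUAL `τ`-CYCLIC LATTICES EXIST IFF THE RATIONAL NORM CLASS IS TRIVIAL, AT A TAME-RAMIFIED
CM PLACE, BOTH TORUS TYPES» — ★ p847163 (seam∘core) ∘ ★ p847219 (LAW) with `hL1` = ★ p847116, the dictionaries = ★ p847291 ∕ ★ `RamifiedPlaceNormDictionary`, and `htrans` =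
★ `UnramifiedQuadraticNormTransferRamifiedPlace`; the brick FILE 2 «R2²-ram ONE-PLACE VALUE» (F0P3a-p08 (g19)) multiplies ★ (D5)-ram by.
-/
import Literature.NumberTheory.Automorphic.RationalCyclicSelfDualLatticesOfLocus          -- ★ p847163 (this seat): `exists_selfDual_cyclic_iff_exists_norm_ramifiedBase_of_frame`
import Literature.NumberTheory.Automorphic.RationalGoodVectorRamifiedBaseLaw              -- ★ p847219 (this seat): `exists_norm_symmCriterion_iff_exists_rational_norm`
import Literature.NumberTheory.Automorphic.UnitaryGroupSelfDualLocusRamifiedThree         -- ★ p847116 (this seat): `exists_mem_unitaryGroupOfForm_mul_iff_of_ramified_three` (= `hL1`)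
import Literature.NumberTheory.NumberFields.UnramifiedQuadraticNormTransferRamifiedPlace  -- ★-to-be (this seat): `htrans` both types at the place; brings parts T, T₀, N, L, D
import HarnessLib

/-!
# The law at a tame-ramified CM place: self-dual `τ`-cyclic lattices exist iff `−θσ̃θ · d₀ · det J · x₀₁x₀₂ · x₁₂²` is a rational norm (Rogawski §4.9; Jacobowitz §7–§8)

Topic `NumberTheory/Automorphic`; namespace `Literature.NumberTheory.Automorphic.SymmetricEigenframe`.  THEOREMS ONLY (no definition, no instance, no notation, no named fact, no
`sorry`); kernel lane `--supports stmt-HodgeConjecture-24833`.  Cell `pub/hodgecm-mathlib` (D-0151), crux H413; road «S3-tree», seeding wave «S3-ram», row (e2) «P-2-ram»∕«R2²-ram»; organ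
**«THE LAW AT THE PLACE»** (this seat; my 00:04:20Z split with F0P3a-p08 (g19): p08's FILE 2 `ncard_selfDual_cyclic_typeTwo_ram_eq_of_model` = ★ p847213 torsor × ★ (D5)-ram × THIS).
Frame: `F ∕ F₀` quadratic number fields (`L ∕ L⁺`), `c ≠ 1`, a place `w₀ ∣ v₀` of `F` fixed by `c`, RAMIFIED and TAME; `σ := galAdicCompletionMap c hw₀` on `F_{w₀} = L_w`; `M ∕ F` with
`w ∣ w₀` (the eigen-field and `W`), `K := M_w`, `ι₁ := toPlace w₀.1 w`; `ε ∈ F_{w₀}` a `σ`-fixed unit with non-square residue, `θ² = ι₁ε` with the unramified coordinates, `s̃`, `ι′`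
the involutions of ★ `UnramifiedQuadraticDictionary` (L2′) as binders; the CM involution of `K` is `σ_K := s̃` (torus TYPE A) or `σ_K := s̃ ∘ ι′` (TYPE B).  Eigen-frame data as in
★ p847163: a `σ`-hermitian `J ∈ GL₃(𝒪_{w₀})`, `τ ∈ M₃(F_{w₀})` diagonalised over `K` by `P` with nodes `γ` (Cayley parameters, `σ_Kγᵢ = γᵢ⁻¹`, integral, distinct, congruent, with
the `ι′`-symmetry `0 ↦ 0, 1 ↔ 2`) and Gram values `d = diag(P^* J P)`.

* **`exists_selfDual_cyclic_iff_rational_norm_typeA_of_ramified`**, **`exists_selfDual_cyclic_iff_rational_norm_typeB_of_ramified`**: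
  `(∃ w, ∃ u ∈ U(σ, J), 𝒪[τ]·w = 𝒪³·uᵀ) ↔ ∃ a, ι′a = a ∧ a·σ_K a·(−(θ·σ_Kθ)·d 0·det(J)·(x₀₁x₀₂)·x₁₂²) = 1` (`x_ij = (γᵢ − γⱼ)∕((1+γᵢ)(1+γⱼ))`) — self-dual `τ`-cyclic
  lattices exist iff the displayed `ι′`-FIXED (rational) `σ_K`-fixed element is a RATIONAL norm, i.e. «`χ_{L_w∕L⁺_v}(−θσ̃θ·d₀·det J·x₀₁x₀₂x₁₂²) = 1`» (CERT 5cd795ce: 841 + 5312 exact cases).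
  Proof: ★ `exists_selfDual_cyclic_iff_exists_norm_ramifiedBase_of_frame` (`hL1` := ★ `exists_mem_unitaryGroupOfForm_mul_iff_of_ramified_three`; dictionaries `hη₀n hnE hnK` := ★
  `UnramifiedQuadraticDictionaryNorms` + ★ `RamifiedPlaceNormDictionary` with `η₀ := ι₁ε`) `.trans` ★ `exists_norm_symmCriterion_iff_exists_rational_norm` (`htrans` := ★
  `exists_norm_iff_exists_rational_norm_typeA_of_ramified` ∕ `…typeB_of_ramified`; `hanti` from the coordinates).  HONEST LABEL: HC_CM is proved only modulo the 2 remaining named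
  inputs (hLiu418 24832, h413 24833) until rung 0 closes; local algebra, count-neutral.

## References
* [Rogawski1990] J. D. Rogawski, *Automorphic Representations of Unitary Groups in Three Variables* (1990): §4.9 Lemma 4.9.3 p. 56, Prop. 4.9.1 (b) p. 55.
* [Jacobowitz1962] R. Jacobowitz, *Hermitian forms over local fields*, Amer. J. Math. 84 (1962): §7 Thm. 7.1, §8.
* [SerreLocalFields1979] J.-P. Serre, *Local Fields*, GTM 67 (1979): Ch. V §3 Cor. 2; Ch. XIV §4.
-/

set_option autoImplicit false

noncomputable section

open Finset Matrix Polynomial NumberField IsDedekindDomain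
open scoped MatrixGroups ValuativeRel WithZero
open ValuativeRel

namespace Literature.NumberTheory.Automorphic.SymmetricEigenframe

open Literature.NumberTheory.Automorphic Literature.NumberTheory.Automorphic.UnitaryGroup Literature.NumberTheory.NumberFields
open Literature.NumberTheory.LocalFields Literature.NumberTheory.LocalFields.RamifiedPlaceNormDictionary
open Literature.NumberTheory.Automorphic.Liu2021.LemD1IndexedNonVacuityRamifiedConverse (valued_galAdicCompletionMap_sub_lt_one_of_ramified)

variable {F₀ F : Type} (M : Type) [Field F₀] [NumberField F₀] [Field F] [NumberField F] [Field M] [NumberField M]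
  [Algebra F₀ F] [Algebra.IsQuadraticExtension F₀ F] [Algebra F M]
  (c : F ≃ₐ[F₀] F) (hc : c ≠ 1) (v₀ : HeightOneSpectrum (𝓞 F₀)) (w₀ : UnitaryGroup.PlacesOver F v₀) (hw₀ : c • w₀.1 = w₀.1) (w : UnitaryGroup.PlacesOver M w₀.1)

include hc in
/-- **THE LAW AT THE PLACE, GENERIC IN THE CM INVOLUTION `σ_K` OF `K`** (private engine of the two heads): ★ p847163 `.trans` ★ p847219 with `hL1`, `hjO`, `hσKv`, `hιj`,
`η₀ := ι₁ε` (`hη₀O hη₀u hιη₀`), `hnE` (★ part N + ★ part D `hnormF`), `hanti` and `hγ1` discharged; the type-specific `hη₀n`, `hnK`, `htrans` stay as hypotheses.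
[cite: Rogawski1990, §4.9 Lemma 4.9.3 p. 56] [cite: Jacobowitz1962, §7 Thm. 7.1] -/
private theorem exists_selfDual_cyclic_iff_rational_norm_of_dictionaries (he : v₀.asIdeal.ramificationIdx' w₀.1.asIdeal ≠ 1)
    (h2 : Valued.v (2 : w₀.1.adicCompletion F) = 1)
    {ε : w₀.1.adicCompletion F} (hσε : galAdicCompletionMap (L := F) c hw₀ ε = ε) (hε1 : Valued.v ε = 1)
    (hεres : ∀ r : w₀.1.adicCompletion F, Valued.v r ≤ 1 → ¬ Valued.v (ε - r ^ 2) < 1)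
    {θ : w.1.adicCompletion M}
    (hval : ∀ p q : w₀.1.adicCompletion F, Valued.v (toPlace w₀.1 w p + toPlace w₀.1 w q * θ) = max (Valued.v p) (Valued.v q))
    (hcoord : ∀ z : w.1.adicCompletion M, ∃ pq : w₀.1.adicCompletion F × w₀.1.adicCompletion F, z = toPlace w₀.1 w pq.1 + toPlace w₀.1 w pq.2 * θ)
    (ι' : w.1.adicCompletion M →+* w.1.adicCompletion M) (hι' : ∀ x, ι' (toPlace w₀.1 w x) = toPlace w₀.1 w x) (hι'θ : ι' θ = -θ)
    (hι'ι' : ∀ z, ι' (ι' z) = z) (hfix : ∀ z : w.1.adicCompletion M, ι' z = z → ∃ x, toPlace w₀.1 w x = z)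
    (σK : w.1.adicCompletion M →+* w.1.adicCompletion M) (hσKj : ∀ x, σK (toPlace w₀.1 w x) = toPlace w₀.1 w (galAdicCompletionMap (L := F) c hw₀ x))
    (hσKv : ∀ z, Valued.v (σK z) = Valued.v z) (hσKσK : ∀ z, σK (σK z) = z) (hσKι : ∀ z, σK (ι' z) = ι' (σK z))
    (hη₀n : ∃ e : w.1.adicCompletion M, e * σK e = toPlace w₀.1 w ε)
    (hnK : ∀ u ∈ 𝒪[w.1.adicCompletion M], (∃ y ∈ 𝒪[w.1.adicCompletion M], y * u = 1) → σK u = u →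
      (∃ f : w.1.adicCompletion M, σK f = f ∧ ι' f = f ∧ Valued.v (u - f) < 1) → ∃ e : w.1.adicCompletion M, e * σK e = u)
    (htrans : ∀ y : w.1.adicCompletion M, y ≠ 0 → σK y = y →
      ((∃ b : w.1.adicCompletion M, b * σK b * y = 1) ↔ ∃ a : w.1.adicCompletion M, ι' a = a ∧ a * σK a * (y * ι' y) = 1))
    (J : GL (Fin 3) (w₀.1.adicCompletion F)) (hJ : J ∈ glInt 3 (w₀.1.adicCompletion F))
    (hJh : ((J : Matrix (Fin 3) (Fin 3) (w₀.1.adicCompletion F)).map (galAdicCompletionMap (L := F) c hw₀))ᵀ = J)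
    (τ : Matrix (Fin 3) (Fin 3) (w₀.1.adicCompletion F))
    (P : GL (Fin 3) (w.1.adicCompletion M)) {γ d : Fin 3 → w.1.adicCompletion M}
    (hτ : τ.map (toPlace w₀.1 w) = (P : Matrix (Fin 3) (Fin 3) (w.1.adicCompletion M)) * diagonal γ * ((P⁻¹ : GL (Fin 3) (w.1.adicCompletion M)) : Matrix (Fin 3) (Fin 3) _))
    (hP : formCongr σK P (((J : Matrix (Fin 3) (Fin 3) (w₀.1.adicCompletion F))).map (toPlace w₀.1 w)) = diagonal d)
    (hP0 : ∀ i, ι' ((P : Matrix (Fin 3) (Fin 3) (w.1.adicCompletion M)) i 0) = (P : Matrix (Fin 3) (Fin 3) (w.1.adicCompletion M)) i 0)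
    (hP1 : ∀ i, ι' ((P : Matrix (Fin 3) (Fin 3) (w.1.adicCompletion M)) i 1) = (P : Matrix (Fin 3) (Fin 3) (w.1.adicCompletion M)) i 2)
    (hP2 : ∀ i, ι' ((P : Matrix (Fin 3) (Fin 3) (w.1.adicCompletion M)) i 2) = (P : Matrix (Fin 3) (Fin 3) (w.1.adicCompletion M)) i 1)
    (hγ : ∀ i, γ i ∈ 𝒪[w.1.adicCompletion M]) (hinj : Function.Injective γ) (hσγ : ∀ i, σK (γ i) = (γ i)⁻¹)
    {r : (𝒪[w.1.adicCompletion M])[X]} (hr : ∀ i, (r.map (𝒪[w.1.adicCompletion M]).subtype).eval (γ i) * γ i = 1)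
    (hγ1u : ∀ i, ∃ y ∈ 𝒪[w.1.adicCompletion M], y * (1 + γ i) = 1) (hγne : ∀ i, γ i ≠ 0) (hγc : ∀ i k, Valued.v (γ i - γ k) < 1)
    (hιγ0 : ι' (γ 0) = γ 0) (hιγ1 : ι' (γ 1) = γ 2) (hιγ2 : ι' (γ 2) = γ 1)
    (hdσ : ∀ i, σK (d i) = d i) (hdne : ∀ i, d i ≠ 0) (hιd0 : ι' (d 0) = d 0) (hιd1 : ι' (d 1) = d 2) :
    (∃ w' : Fin 3 → w₀.1.adicCompletion F, ∃ u ∈ unitaryGroupOfForm (galAdicCompletionMap (L := F) c hw₀) (J : Matrix (Fin 3) (Fin 3) (w₀.1.adicCompletion F)),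
      Submodule.span 𝒪[w₀.1.adicCompletion F] (Set.range fun k : Fin 3 => (τ ^ (k : ℕ)) *ᵥ w') =
        Submodule.span 𝒪[w₀.1.adicCompletion F] (Set.range ((u : Matrix (Fin 3) (Fin 3) (w₀.1.adicCompletion F)))ᵀ)) ↔
    ∃ a : w.1.adicCompletion M, ι' a = a ∧ a * σK a * (-(θ * σK θ) * d 0 * (((J : Matrix (Fin 3) (Fin 3) (w₀.1.adicCompletion F))).map (toPlace w₀.1 w)).det *
      ((γ 0 - γ 1) / ((1 + γ 0) * (1 + γ 1)) * ((γ 0 - γ 2) / ((1 + γ 0) * (1 + γ 2)))) * ((γ 1 - γ 2) / ((1 + γ 1) * (1 + γ 2))) ^ 2) = 1 := by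
  -- valuations along `ι₁`
  have hιv : ∀ x, Valued.v (toPlace w₀.1 w x) = Valued.v x := fun x => by
    have h := hval x 0
    rwa [map_zero, zero_mul, add_zero, map_zero, max_eq_left zero_le] at h
  have hθv : Valued.v θ = 1 := by
    have h := hval 0 1
    rwa [map_zero, map_one, zero_add, one_mul, map_zero, map_one, max_eq_right zero_le] at h
  have hθ0 : θ ≠ 0 := fun h => by rw [h, map_zero] at hθv; exact zero_ne_one hθv
  have h2K : Valued.v (2 : w.1.adicCompletion M) = 1 := by rw [← map_ofNat (toPlace w₀.1 w) 2, hιv]; exact h2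
  have h20 : (2 : w.1.adicCompletion M) ≠ 0 := fun h => by rw [h, map_zero] at h2K; exact zero_ne_one h2K
  have h2O : IsUnit (2 : 𝒪[w₀.1.adicCompletion F]) := isUnit_two_integer_of_v_two_eq_one w₀.1 h2
  -- the residue of `ε` is a non-square; the anti-fixed uniformiser of `F_{w₀}`
  have hεns : ¬ IsSquare (IsLocalRing.residue 𝒪[w₀.1.adicCompletion F] ⟨ε, (v_le_one_iff_mem_integer ε).1 hε1.le⟩) := fun h => by
    obtain ⟨r', hr', hεr⟩ := (isSquare_residue_iff_exists_valued_sub_sq_lt_one F v₀ w₀ hε1).1 h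
    exact hεres r' hr' hεr
  obtain ⟨ϖ, hϖ, hσϖ⟩ := exists_uniformizer_galAdicCompletionMap_eq_neg_of_ramified F c hc w₀ hw₀ he h2
  -- (1) `hL1` := ★ p847116
  have hL1 : ∀ g : GL (Fin 3) (w₀.1.adicCompletion F),
      (∃ u ∈ unitaryGroupOfForm (galAdicCompletionMap (L := F) c hw₀) (J : Matrix (Fin 3) (Fin 3) (w₀.1.adicCompletion F)),
        ∃ k ∈ glInt 3 (w₀.1.adicCompletion F), g = u * k) ↔
      ∃ J' ∈ glInt 3 (w₀.1.adicCompletion F), (J' : Matrix (Fin 3) (Fin 3) (w₀.1.adicCompletion F)) =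
        formCongr (galAdicCompletionMap (L := F) c hw₀) g (J : Matrix (Fin 3) (Fin 3) (w₀.1.adicCompletion F)) := fun g =>
    exists_mem_unitaryGroupOfForm_mul_iff_of_ramified_three c w₀ hc hw₀ he h2O J hJ hJh g
  -- (2) the transfer data along `ι₁`
  have hjO : ∀ x : w₀.1.adicCompletion F, toPlace w₀.1 w x ∈ 𝒪[w.1.adicCompletion M] ↔ x ∈ 𝒪[w₀.1.adicCompletion F] := fun x => by
    rw [← v_le_one_iff_mem_integer, ← v_le_one_iff_mem_integer, hιv]
  have hσKv' : ∀ y, valuation (w.1.adicCompletion M) (σK y) = valuation (w.1.adicCompletion M) y := fun y =>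
    (v_eq_iff_valuation_eq _ _).1 (hσKv y)
  have hιj : ∀ y : w.1.adicCompletion M, ι' y = y ↔ ∃ x, toPlace w₀.1 w x = y :=
    fun y => ⟨hfix y, fun ⟨x, hx⟩ => by rw [← hx, hι']⟩
  -- (3) `η₀ := ι₁ ε`
  have hη₀O : toPlace w₀.1 w ε ∈ 𝒪[w.1.adicCompletion M] := (v_le_one_iff_mem_integer _).1 (by rw [hιv, hε1])
  have hε0 : ε ≠ 0 := fun h => by rw [h, map_zero] at hε1; exact zero_ne_one hε1
  have hη₀u : ∃ y ∈ 𝒪[w.1.adicCompletion M], y * toPlace w₀.1 w ε = 1 :=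
    ⟨toPlace w₀.1 w ε⁻¹, (v_le_one_iff_mem_integer _).1 (by rw [hιv, map_inv₀, hε1, inv_one]),
      by rw [← map_mul, inv_mul_cancel₀ hε0, map_one]⟩
  have hιη₀ : ι' (toPlace w₀.1 w ε) = toPlace w₀.1 w ε := hι' ε
  -- (4) `hnE` := ★ part N over ★ part D `hnormF` (with `η := ε`)
  have hnE : ∀ c' : w.1.adicCompletion M, c' ≠ 0 → σK c' = c' → ι' c' = c' →
      ∃ a : w.1.adicCompletion M, ι' a = a ∧ (a * σK a * c' = 1 ∨ a * σK a * c' = toPlace w₀.1 w ε) := fun c' hc' hσc' hιc' =>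
    exists_rational_norm_mul_eq_one_or_eq_toPlace M w₀.1 w (galAdicCompletionMap (L := F) c hw₀)
      (exists_mul_galAdicCompletionMap_mul_eq_one_or_eq_of_ramified F c hc v₀ w₀ hw₀ he h2 hε1 hσε hεns hϖ hσϖ) σK ι' hσKj hι' hfix c' hc' hσc' hιc'
  -- (5) `hanti`, `hγ1`
  have hanti : ∀ z : w.1.adicCompletion M, ι' z = -z → ∃ b : w.1.adicCompletion M, ι' b = b ∧ z = b * θ := by
    intro z hz
    obtain ⟨⟨p, q⟩, rfl⟩ := hcoord z
    have h1 : ι' (toPlace w₀.1 w p + toPlace w₀.1 w q * θ) = toPlace w₀.1 w p - toPlace w₀.1 w q * θ := by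
      rw [map_add, map_mul, hι', hι', hι'θ]; ring
    rw [h1] at hz
    have hp0 : toPlace w₀.1 w p = 0 := by
      have h2p : (2 : w.1.adicCompletion M) * toPlace w₀.1 w p = 0 := by linear_combination hz
      rcases mul_eq_zero.1 h2p with h | h
      · exact absurd h h20
      · exact h
    refine ⟨toPlace w₀.1 w q, hι' q, ?_⟩
    simp only [hp0, zero_add]
  have hγ1 : ∀ i, 1 + γ i ≠ 0 := fun i h => by
    obtain ⟨y, -, hy⟩ := hγ1u i
    rw [h, mul_zero] at hy
    exact zero_ne_one hy
  -- compose
  exact (exists_selfDual_cyclic_iff_exists_norm_ramifiedBase_of_frame (galAdicCompletionMap (L := F) c hw₀) J hL1 τ (toPlace w₀.1 w) hjO σK hσKj hσKv'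
    hσKσK ι' hι'ι' hιj hσKι P hτ hP hP0 hP1 hP2 hγ hinj hσγ hr hγ1u hγne hγc hιγ0 hιγ1 hιγ2 hdσ hdne hιd0 hιd1 hη₀O hη₀u hιη₀ hη₀n hnE hnK).trans
    (exists_norm_symmCriterion_iff_exists_rational_norm σK ι' htrans hθ0 hanti _ P hP hP0 hP1 hP2 hγ1 hσγ hγne hinj hιγ0 hιγ1 hιγ2 hdσ hdne hιd0 hιd1)

include hc in
/-- **THE LAW AT A TAME-RAMIFIED CM PLACE, TORUS TYPE A** (`σ_K := s̃`, `s̃θ = θ`): self-dual `τ`-cyclic `𝒪_{w₀}`-lattices for the `σ_{w₀}`-hermitian `J` exist iff the rational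
`σ_K`-fixed element `−(θ·s̃θ)·d 0·det J·(x₀₁x₀₂)·x₁₂²` is a rational norm (`∃ a, ι′a = a ∧ a·s̃a·(…) = 1`).  Dictionaries: `hη₀n` := `θ·s̃θ = ι₁ε` (★ part N), `hnK` := ★ part N
`exists_mul_map_eq_of_fixed_unit_near_rational_typeA` (with ★ part D `hsqF`), `htrans` := ★ `exists_norm_iff_exists_rational_norm_typeA_of_ramified`.
[cite: Rogawski1990, §4.9 Lemma 4.9.3 p. 56] [cite: Jacobowitz1962, §7 Thm. 7.1, §8] [cite: SerreLocalFields1979, Ch. V §3 Cor. 2] -/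
theorem exists_selfDual_cyclic_iff_rational_norm_typeA_of_ramified (he : v₀.asIdeal.ramificationIdx' w₀.1.asIdeal ≠ 1)
    (h2 : Valued.v (2 : w₀.1.adicCompletion F) = 1)
    {ε : w₀.1.adicCompletion F} (hσε : galAdicCompletionMap (L := F) c hw₀ ε = ε) (hε1 : Valued.v ε = 1)
    (hεres : ∀ r : w₀.1.adicCompletion F, Valued.v r ≤ 1 → ¬ Valued.v (ε - r ^ 2) < 1)
    {θ : w.1.adicCompletion M} (hθ : θ ^ 2 = toPlace w₀.1 w ε)
    (hval : ∀ p q : w₀.1.adicCompletion F, Valued.v (toPlace w₀.1 w p + toPlace w₀.1 w q * θ) = max (Valued.v p) (Valued.v q))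
    (hcoord : ∀ z : w.1.adicCompletion M, ∃ pq : w₀.1.adicCompletion F × w₀.1.adicCompletion F, z = toPlace w₀.1 w pq.1 + toPlace w₀.1 w pq.2 * θ)
    (s' ι' : w.1.adicCompletion M →+* w.1.adicCompletion M)
    (hs' : ∀ x, s' (toPlace w₀.1 w x) = toPlace w₀.1 w (galAdicCompletionMap (L := F) c hw₀ x)) (hs'θ : s' θ = θ)
    (hs's' : ∀ z, s' (s' z) = z) (hs'v : ∀ z, Valued.v (s' z) = Valued.v z)
    (hι' : ∀ x, ι' (toPlace w₀.1 w x) = toPlace w₀.1 w x) (hι'θ : ι' θ = -θ) (hι'ι' : ∀ z, ι' (ι' z) = z) (hι'v : ∀ z, Valued.v (ι' z) = Valued.v z)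
    (hcomm : ∀ z, s' (ι' z) = ι' (s' z)) (hfix : ∀ z : w.1.adicCompletion M, ι' z = z → ∃ x, toPlace w₀.1 w x = z)
    (J : GL (Fin 3) (w₀.1.adicCompletion F)) (hJ : J ∈ glInt 3 (w₀.1.adicCompletion F))
    (hJh : ((J : Matrix (Fin 3) (Fin 3) (w₀.1.adicCompletion F)).map (galAdicCompletionMap (L := F) c hw₀))ᵀ = J)
    (τ : Matrix (Fin 3) (Fin 3) (w₀.1.adicCompletion F))
    (P : GL (Fin 3) (w.1.adicCompletion M)) {γ d : Fin 3 → w.1.adicCompletion M}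
    (hτ : τ.map (toPlace w₀.1 w) = (P : Matrix (Fin 3) (Fin 3) (w.1.adicCompletion M)) * diagonal γ * ((P⁻¹ : GL (Fin 3) (w.1.adicCompletion M)) : Matrix (Fin 3) (Fin 3) _))
    (hP : formCongr s' P (((J : Matrix (Fin 3) (Fin 3) (w₀.1.adicCompletion F))).map (toPlace w₀.1 w)) = diagonal d)
    (hP0 : ∀ i, ι' ((P : Matrix (Fin 3) (Fin 3) (w.1.adicCompletion M)) i 0) = (P : Matrix (Fin 3) (Fin 3) (w.1.adicCompletion M)) i 0)
    (hP1 : ∀ i, ι' ((P : Matrix (Fin 3) (Fin 3) (w.1.adicCompletion M)) i 1) = (P : Matrix (Fin 3) (Fin 3) (w.1.adicCompletion M)) i 2)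
    (hP2 : ∀ i, ι' ((P : Matrix (Fin 3) (Fin 3) (w.1.adicCompletion M)) i 2) = (P : Matrix (Fin 3) (Fin 3) (w.1.adicCompletion M)) i 1)
    (hγ : ∀ i, γ i ∈ 𝒪[w.1.adicCompletion M]) (hinj : Function.Injective γ) (hσγ : ∀ i, s' (γ i) = (γ i)⁻¹)
    {r : (𝒪[w.1.adicCompletion M])[X]} (hr : ∀ i, (r.map (𝒪[w.1.adicCompletion M]).subtype).eval (γ i) * γ i = 1)
    (hγ1u : ∀ i, ∃ y ∈ 𝒪[w.1.adicCompletion M], y * (1 + γ i) = 1) (hγne : ∀ i, γ i ≠ 0) (hγc : ∀ i k, Valued.v (γ i - γ k) < 1)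
    (hιγ0 : ι' (γ 0) = γ 0) (hιγ1 : ι' (γ 1) = γ 2) (hιγ2 : ι' (γ 2) = γ 1)
    (hdσ : ∀ i, s' (d i) = d i) (hdne : ∀ i, d i ≠ 0) (hιd0 : ι' (d 0) = d 0) (hιd1 : ι' (d 1) = d 2) :
    (∃ w' : Fin 3 → w₀.1.adicCompletion F, ∃ u ∈ unitaryGroupOfForm (galAdicCompletionMap (L := F) c hw₀) (J : Matrix (Fin 3) (Fin 3) (w₀.1.adicCompletion F)),
      Submodule.span 𝒪[w₀.1.adicCompletion F] (Set.range fun k : Fin 3 => (τ ^ (k : ℕ)) *ᵥ w') =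
        Submodule.span 𝒪[w₀.1.adicCompletion F] (Set.range ((u : Matrix (Fin 3) (Fin 3) (w₀.1.adicCompletion F)))ᵀ)) ↔
    ∃ a : w.1.adicCompletion M, ι' a = a ∧ a * s' a * (-(θ * s' θ) * d 0 * (((J : Matrix (Fin 3) (Fin 3) (w₀.1.adicCompletion F))).map (toPlace w₀.1 w)).det *
      ((γ 0 - γ 1) / ((1 + γ 0) * (1 + γ 1)) * ((γ 0 - γ 2) / ((1 + γ 0) * (1 + γ 2)))) * ((γ 1 - γ 2) / ((1 + γ 1) * (1 + γ 2))) ^ 2) = 1 := by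
  have hιv : ∀ x, Valued.v (toPlace w₀.1 w x) = Valued.v x := fun x => by
    have h := hval x 0
    rwa [map_zero, zero_mul, add_zero, map_zero, max_eq_left zero_le] at h
  have hθv : Valued.v θ = 1 := by
    have h := hval 0 1
    rwa [map_zero, map_one, zero_add, one_mul, map_zero, map_one, max_eq_right zero_le] at h
  have h2K : Valued.v (2 : w.1.adicCompletion M) = 1 := by rw [← map_ofNat (toPlace w₀.1 w) 2, hιv]; exact h2
  have hεns : ¬ IsSquare (IsLocalRing.residue 𝒪[w₀.1.adicCompletion F] ⟨ε, (v_le_one_iff_mem_integer ε).1 hε1.le⟩) := fun h => by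
    obtain ⟨r', hr', hεr⟩ := (isSquare_residue_iff_exists_valued_sub_sq_lt_one F v₀ w₀ hε1).1 h
    exact hεres r' hr' hεr
  have hs'O : ∀ z : 𝒪[w.1.adicCompletion M], s' z ∈ 𝒪[w.1.adicCompletion M] := fun z =>
    (v_le_one_iff_mem_integer _).1 (by rw [hs'v]; exact (v_le_one_iff_mem_integer (z : w.1.adicCompletion M)).2 z.2)
  -- `hnK` (type A): ★ part N with ★ part D's dichotomy
  have hnK : ∀ u ∈ 𝒪[w.1.adicCompletion M], (∃ y ∈ 𝒪[w.1.adicCompletion M], y * u = 1) → s' u = u →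
      (∃ f : w.1.adicCompletion M, s' f = f ∧ ι' f = f ∧ Valued.v (u - f) < 1) → ∃ e : w.1.adicCompletion M, e * s' e = u := by
    intro u huO hy hsu hnear
    have hu1 : Valued.v u = 1 := by
      obtain ⟨y, hyO, hyu⟩ := hy
      have hle : Valued.v u ≤ 1 := (v_le_one_iff_mem_integer u).2 huO
      refine le_antisymm hle (not_lt.1 fun hlt => ?_)
      have h1 : Valued.v (y * u) < 1 := by
        rw [map_mul]
        calc Valued.v y * Valued.v u ≤ Valued.v u := mul_le_of_le_one_left' ((v_le_one_iff_mem_integer y).2 hyO)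
          _ < 1 := hlt
      rw [hyu, map_one] at h1
      exact lt_irrefl _ h1
    exact exists_mul_map_eq_of_fixed_unit_near_rational_typeA M w₀.1 w h2K (galAdicCompletionMap (L := F) c hw₀)
      (fun x hx => valued_galAdicCompletionMap_sub_lt_one_of_ramified F c v₀ hc w₀ hw₀ he x hx)
      (fun g hg _ => exists_valued_sub_sq_lt_one_or_of_ramified F c hc v₀ w₀ hw₀ he h2 hε1 hσε hεns g hg)
      hθ hθv hval hcoord s' ι' hs' hs'θ hs's' hs'O hfix ⟨u, huO⟩ hu1 hsu hnear
  exact exists_selfDual_cyclic_iff_rational_norm_of_dictionaries M c hc v₀ w₀ hw₀ w he h2 hσε hε1 hεres hval hcoord ι' hι' hι'θ hι'ι' hfix s' hs' hs'v hs's' hcomm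
    ⟨θ, theta_mul_map_theta_eq_toPlace M w₀.1 w hθ s' hs'θ⟩ hnK
    (fun y hy hσy => exists_norm_iff_exists_rational_norm_typeA_of_ramified M c hc v₀ w₀ hw₀ w he h2 hσε hε1 hεres hθ hval hcoord s' ι' hs' hs'θ hs's' hs'v
      hι' hι'θ hι'v hfix y hy hσy)
    J hJ hJh τ P hτ hP hP0 hP1 hP2 hγ hinj hσγ hr hγ1u hγne hγc hιγ0 hιγ1 hιγ2 hdσ hdne hιd0 hιd1

include hc in
/-- **THE LAW AT A TAME-RAMIFIED CM PLACE, TORUS TYPE B** (`σ_K := s̃ ∘ ι′`): as type A with `s̃ι′` for `s̃`.  Dictionaries: `hη₀n` := ★ part N `exists_mul_map_comp_eq_toPlace`, `hnK` := ★ part N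
`exists_mul_map_comp_eq_of_fixed_unit_typeB`, `htrans` := ★ `exists_norm_comp_iff_exists_rational_norm_typeB_of_ramified`.
[cite: Rogawski1990, §4.9 Lemma 4.9.3 p. 56] [cite: Jacobowitz1962, §7 Thm. 7.1, §8] [cite: SerreLocalFields1979, Ch. V §2 Prop. 3; Ch. XIV §4] -/
theorem exists_selfDual_cyclic_iff_rational_norm_typeB_of_ramified (he : v₀.asIdeal.ramificationIdx' w₀.1.asIdeal ≠ 1)
    (h2 : Valued.v (2 : w₀.1.adicCompletion F) = 1)
    {ε : w₀.1.adicCompletion F} (hσε : galAdicCompletionMap (L := F) c hw₀ ε = ε) (hε1 : Valued.v ε = 1)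
    (hεres : ∀ r : w₀.1.adicCompletion F, Valued.v r ≤ 1 → ¬ Valued.v (ε - r ^ 2) < 1)
    {θ : w.1.adicCompletion M} (hθ : θ ^ 2 = toPlace w₀.1 w ε)
    (hval : ∀ p q : w₀.1.adicCompletion F, Valued.v (toPlace w₀.1 w p + toPlace w₀.1 w q * θ) = max (Valued.v p) (Valued.v q))
    (hcoord : ∀ z : w.1.adicCompletion M, ∃ pq : w₀.1.adicCompletion F × w₀.1.adicCompletion F, z = toPlace w₀.1 w pq.1 + toPlace w₀.1 w pq.2 * θ)
    (s' ι' : w.1.adicCompletion M →+* w.1.adicCompletion M)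
    (hs' : ∀ x, s' (toPlace w₀.1 w x) = toPlace w₀.1 w (galAdicCompletionMap (L := F) c hw₀ x)) (hs'θ : s' θ = θ)
    (hs's' : ∀ z, s' (s' z) = z) (hs'v : ∀ z, Valued.v (s' z) = Valued.v z)
    (hι' : ∀ x, ι' (toPlace w₀.1 w x) = toPlace w₀.1 w x) (hι'θ : ι' θ = -θ) (hι'ι' : ∀ z, ι' (ι' z) = z) (hι'v : ∀ z, Valued.v (ι' z) = Valued.v z)
    (hcomm : ∀ z, s' (ι' z) = ι' (s' z)) (hfix : ∀ z : w.1.adicCompletion M, ι' z = z → ∃ x, toPlace w₀.1 w x = z)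
    (J : GL (Fin 3) (w₀.1.adicCompletion F)) (hJ : J ∈ glInt 3 (w₀.1.adicCompletion F))
    (hJh : ((J : Matrix (Fin 3) (Fin 3) (w₀.1.adicCompletion F)).map (galAdicCompletionMap (L := F) c hw₀))ᵀ = J)
    (τ : Matrix (Fin 3) (Fin 3) (w₀.1.adicCompletion F))
    (P : GL (Fin 3) (w.1.adicCompletion M)) {γ d : Fin 3 → w.1.adicCompletion M}
    (hτ : τ.map (toPlace w₀.1 w) = (P : Matrix (Fin 3) (Fin 3) (w.1.adicCompletion M)) * diagonal γ * ((P⁻¹ : GL (Fin 3) (w.1.adicCompletion M)) : Matrix (Fin 3) (Fin 3) _))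
    (hP : formCongr (s'.comp ι') P (((J : Matrix (Fin 3) (Fin 3) (w₀.1.adicCompletion F))).map (toPlace w₀.1 w)) = diagonal d)
    (hP0 : ∀ i, ι' ((P : Matrix (Fin 3) (Fin 3) (w.1.adicCompletion M)) i 0) = (P : Matrix (Fin 3) (Fin 3) (w.1.adicCompletion M)) i 0)
    (hP1 : ∀ i, ι' ((P : Matrix (Fin 3) (Fin 3) (w.1.adicCompletion M)) i 1) = (P : Matrix (Fin 3) (Fin 3) (w.1.adicCompletion M)) i 2)
    (hP2 : ∀ i, ι' ((P : Matrix (Fin 3) (Fin 3) (w.1.adicCompletion M)) i 2) = (P : Matrix (Fin 3) (Fin 3) (w.1.adicCompletion M)) i 1)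
    (hγ : ∀ i, γ i ∈ 𝒪[w.1.adicCompletion M]) (hinj : Function.Injective γ) (hσγ : ∀ i, (s'.comp ι') (γ i) = (γ i)⁻¹)
    {r : (𝒪[w.1.adicCompletion M])[X]} (hr : ∀ i, (r.map (𝒪[w.1.adicCompletion M]).subtype).eval (γ i) * γ i = 1)
    (hγ1u : ∀ i, ∃ y ∈ 𝒪[w.1.adicCompletion M], y * (1 + γ i) = 1) (hγne : ∀ i, γ i ≠ 0) (hγc : ∀ i k, Valued.v (γ i - γ k) < 1)
    (hιγ0 : ι' (γ 0) = γ 0) (hιγ1 : ι' (γ 1) = γ 2) (hιγ2 : ι' (γ 2) = γ 1)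
    (hdσ : ∀ i, (s'.comp ι') (d i) = d i) (hdne : ∀ i, d i ≠ 0) (hιd0 : ι' (d 0) = d 0) (hιd1 : ι' (d 1) = d 2) :
    (∃ w' : Fin 3 → w₀.1.adicCompletion F, ∃ u ∈ unitaryGroupOfForm (galAdicCompletionMap (L := F) c hw₀) (J : Matrix (Fin 3) (Fin 3) (w₀.1.adicCompletion F)),
      Submodule.span 𝒪[w₀.1.adicCompletion F] (Set.range fun k : Fin 3 => (τ ^ (k : ℕ)) *ᵥ w') =
        Submodule.span 𝒪[w₀.1.adicCompletion F] (Set.range ((u : Matrix (Fin 3) (Fin 3) (w₀.1.adicCompletion F)))ᵀ)) ↔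
    ∃ a : w.1.adicCompletion M, ι' a = a ∧ a * (s'.comp ι') a * (-(θ * (s'.comp ι') θ) * d 0 *
      (((J : Matrix (Fin 3) (Fin 3) (w₀.1.adicCompletion F))).map (toPlace w₀.1 w)).det *
      ((γ 0 - γ 1) / ((1 + γ 0) * (1 + γ 1)) * ((γ 0 - γ 2) / ((1 + γ 0) * (1 + γ 2)))) * ((γ 1 - γ 2) / ((1 + γ 1) * (1 + γ 2))) ^ 2) = 1 := by
  have hιv : ∀ x, Valued.v (toPlace w₀.1 w x) = Valued.v x := fun x => by
    have h := hval x 0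
    rwa [map_zero, zero_mul, add_zero, map_zero, max_eq_left zero_le] at h
  have hθv : Valued.v θ = 1 := by
    have h := hval 0 1
    rwa [map_zero, map_one, zero_add, one_mul, map_zero, map_one, max_eq_right zero_le] at h
  have h2K : Valued.v (2 : w.1.adicCompletion M) = 1 := by rw [← map_ofNat (toPlace w₀.1 w) 2, hιv]; exact h2
  have hs'O : ∀ z : 𝒪[w.1.adicCompletion M], s' z ∈ 𝒪[w.1.adicCompletion M] := fun z =>
    (v_le_one_iff_mem_integer _).1 (by rw [hs'v]; exact (v_le_one_iff_mem_integer (z : w.1.adicCompletion M)).2 z.2)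
  have hι'O : ∀ z : 𝒪[w.1.adicCompletion M], ι' z ∈ 𝒪[w.1.adicCompletion M] := fun z =>
    (v_le_one_iff_mem_integer _).1 (by rw [hι'v]; exact (v_le_one_iff_mem_integer (z : w.1.adicCompletion M)).2 z.2)
  -- the involution `σ_K := s̃ι′`
  have hσKj : ∀ x, (s'.comp ι') (toPlace w₀.1 w x) = toPlace w₀.1 w (galAdicCompletionMap (L := F) c hw₀ x) := fun x => by
    rw [RingHom.comp_apply, hι', hs']
  have hσKv : ∀ z, Valued.v ((s'.comp ι') z) = Valued.v z := fun z => by rw [RingHom.comp_apply, hs'v, hι'v]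
  have hσKσK : ∀ z, (s'.comp ι') ((s'.comp ι') z) = z := fun z => by
    rw [RingHom.comp_apply, RingHom.comp_apply, ← hcomm, hs's', hι'ι']
  have hσKι : ∀ z, (s'.comp ι') (ι' z) = ι' ((s'.comp ι') z) := fun z => by rw [RingHom.comp_apply, RingHom.comp_apply, hcomm]
  -- `hnK` (type B): every fixed unit is a norm
  have hnK : ∀ u ∈ 𝒪[w.1.adicCompletion M], (∃ y ∈ 𝒪[w.1.adicCompletion M], y * u = 1) → (s'.comp ι') u = u →
      (∃ f : w.1.adicCompletion M, (s'.comp ι') f = f ∧ ι' f = f ∧ Valued.v (u - f) < 1) → ∃ e : w.1.adicCompletion M, e * (s'.comp ι') e = u := by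
    intro u huO hy hsu _
    have hu1 : Valued.v u = 1 := by
      obtain ⟨y, hyO, hyu⟩ := hy
      have hle : Valued.v u ≤ 1 := (v_le_one_iff_mem_integer u).2 huO
      refine le_antisymm hle (not_lt.1 fun hlt => ?_)
      have h1 : Valued.v (y * u) < 1 := by
        rw [map_mul]
        calc Valued.v y * Valued.v u ≤ Valued.v u := mul_le_of_le_one_left' ((v_le_one_iff_mem_integer y).2 hyO)
          _ < 1 := hlt
      rw [hyu, map_one] at h1
      exact lt_irrefl _ h1
    exact exists_mul_map_comp_eq_of_fixed_unit_typeB M w₀.1 w h2K hθv s' ι' hs'θ hs's' hs'O hι'θ hι'ι' hι'O hcomm ⟨u, huO⟩ hu1 hsu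
  exact exists_selfDual_cyclic_iff_rational_norm_of_dictionaries M c hc v₀ w₀ hw₀ w he h2 hσε hε1 hεres hval hcoord ι' hι' hι'θ hι'ι' hfix (s'.comp ι')
    hσKj hσKv hσKσK hσKι
    (exists_mul_map_comp_eq_toPlace M w₀.1 w h2K hθv (by rw [hιv]; exact hε1) (galAdicCompletionMap (L := F) c hw₀) hσε s' ι' hs' hs'θ hs's' hs'O
      hι' hι'θ hι'ι' hι'O hcomm)
    hnK
    (fun y hy hσy => exists_norm_comp_iff_exists_rational_norm_typeB_of_ramified M c hc v₀ w₀ hw₀ w he h2 hσε hε1 hεres hθ hval hcoord s' ι' hs' hs'θ hs's'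
      hs'v hι' hι'θ hι'ι' hι'v hcomm hfix y hy hσy)
    J hJ hJh τ P hτ hP hP0 hP1 hP2 hγ hinj hσγ hr hγ1u hγne hγc hιγ0 hιγ1 hιγ2 hdσ hdne hιd0 hιd1

end Literature.NumberTheory.Automorphic.SymmetricEigenframe

end
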